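import Summits.BirchSwinnertonDyer.BirchSwinnertonDyer.Theorems.GenusKolyvaginAtTwoVisiblePairAtTwoDefs
import Summits.BirchSwinnertonDyer.BirchSwinnertonDyer.Theorems.GenusKolyvaginAtTwoEquivariantKolyvaginExactAtTwoSelmerDescentRamified
import Summits.BirchSwinnertonDyer.BirchSwinnertonDyer.Theorems.GenusKolyvaginAtTwoEquivariantKolyvaginExactAtTwoArchimedeanSelmerLevel
import HarnessLib

/-!
# Route `GenusKolyvaginAtTwo`, LINE 6, KEY crux Q3 (inner statement of stmt-BirchSwinnertonDyer-22137):
# REDUCTIONS of the displayed Lemma-4.3 inputs of the pair instance (`Input.loc_c₁_fin/inf`, `loc_c₂_fin/inf` of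
# `…VisiblePairAtTwoDefs`) to McCallum's Lemma 4.3 OVER `K`, place by place

Helper (seat `bsd-line-gk2-p3` g12; `--supports` the crux, closes nothing). The record `Input` of
`Theorems/GenusKolyvaginAtTwoVisiblePairAtTwoDefs.lean` displays McCallum's Lemma 4.3 OVER `ℚ` for the descended
classes (`c₁ m` on `E`, `c₂ m` on `E^{(d_K)}`) at every place not dividing the depth `m`. This file shows how much
of it is the `K`-statement (Lemma 4.3 for `c_K(m)` at the places `w ∤ m` of `K`, [McCallumLMS1991] §4) read through
this lineage's transfer theorems, and what remains a genuine hypothesis over `ℚ`: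

* `mem_selmerLocalKer_of_K` (member `E`, one place): at an ODD place `v ∤ n` of good reduction for `E`: from the
  `K`-level condition at the places above `v` — via `…SelmerDescentQuadratic` if `v ∤ d_K` (unramified), via
  `…SelmerDescentRamified` if `v ∣ d_K` under the DEF-free hypothesis at `v` (no `D_𝔓`-fixed point of order `2`);
* `mem_selmerLocalKer_twin_of_K` (member `E^{(d_K)}`, one place): at an odd place `v ∤ d_K n` of good reduction
  for `E` and `E^{(d_K)}` (`hPsiKT` + `…SelmerDescentQuadratic` for the twin equation);
* `loc_c₁_fin_of_K`, `loc_c₂_fin_of_K` — the fields `Input.loc_c₁_fin`, `Input.loc_c₂_fin` from: Lemma 4.3 over `K`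
  for `c_K`; the descent identities; the DEF-free hypothesis at the primes of `d_K` (member `E` only); and the
  RESIDUAL ℚ-hypotheses at the places `v ∋ 2`, `v` bad for `E` (member `E`), resp. `v ∋ 2`, `v` bad, `v ∣ d_K`
  (member `E^{(d_K)}`, additive there);
* `loc_c₁_inf_of_Δ_neg`, `loc_c₂_inf_of_Δ_neg` — the fields `Input.loc_c₁_inf`, `loc_c₂_inf` are FREE on `Δ < 0`
  (`…ArchimedeanSelmerLevel`).

THEOREMS ONLY (no definition, no named fact, no `sorry`, standard axioms). BSD is not proved by any of this.

References: [McCallumLMS1991] §4 Lemma 4.3; [GrossLMS1991] Prop. 6.2 (1); [Kolyvagin1989Izv] §3; [MilneADT2006] I Rem. 3.7.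
-/

set_option autoImplicit false
set_option linter.dupNamespace false -- tree convention: `Summit.BirchSwinnertonDyer.BirchSwinnertonDyer.Theorems` (summit = sub-problem)

noncomputable section

open scoped Classical

namespace Summit.BirchSwinnertonDyer.BirchSwinnertonDyer.Theorems.GenusExact.VisiblePairAtTwo

open WeierstrassCurve NumberField IsDedekindDomain Field Rat.HeightOneSpectrum
open Literature.NumberTheory.EllipticCurves Literature.NumberTheory.GaloisRepresentations
open Literature.NumberTheory.EllipticCurves.KolyvaginDescent
open Summit.BirchSwinnertonDyer.BirchSwinnertonDyer.Theorems.GenusExact.SelmerDescent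
open Summit.BirchSwinnertonDyer.BirchSwinnertonDyer.Theorems.GenusExact.EigenClassesFinite
open Summit.BirchSwinnertonDyer.BirchSwinnertonDyer.Theorems.GenusExact.ArchVanishing

variable {K : Type} [Field K] [NumberField K] (W : WeierstrassCurve ℚ) [W.IsElliptic]

/-! ## §1 One place at a time -/

/-- **Member `E`, one odd good place `v ∤ n`**: the ℚ-level Selmer condition of `u` at `v` from the `K`-level
condition of `c_K = res u` at the places above `v` — unramified case (`v ∤ c`) by `…SelmerDescentQuadratic`,
ramified case (`v ∣ c`) by `…SelmerDescentRamified` under the DEF-free hypothesis at `v`. (`K = ℚ(θ)`, `θ² = c ∈ ℤ`.)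
[cite: McCallumLMS1991, §4 Lemma 4.3] -/
theorem mem_selmerLocalKer_of_K (h2 : Module.finrank ℚ K = 2) {θ : K} (hθ : θ ∉ (algebraMap ℚ K).range)
    {c : ℤ} (hc : θ ^ 2 = algebraMap ℚ K c) (n : ℤ) {u : galH1Torsion W n}
    {cK : galH1Torsion (W.baseChange K) n} (hu : resTorsion W K n u = cK) (v : HeightOneSpectrum (𝓞 ℚ))
    (hgood : W.HasGoodReductionAt v) (hn : (n : 𝓞 ℚ) ∉ v.asIdeal) (h2v : (2 : 𝓞 ℚ) ∉ v.asIdeal)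
    (hK : ∀ (w : HeightOneSpectrum (𝓞 K)) [w.asIdeal.LiesOver v.asIdeal],
      cK ∈ selmerLocalKer (W.baseChange K) (w.adicCompletion K) n)
    (hdef : ((c : ℤ) : 𝓞 ℚ) ∈ v.asIdeal → ∀ (w : HeightOneSpectrum (𝓞 K)) [w.asIdeal.LiesOver v.asIdeal],
      ∀ 𝔔 ∈ w.primesAbove, ∀ T : geomTorsion W n, 2 • T = 0 →
        (∀ g ∈ (𝔔.comap (absIntegersMap ℚ K)).decompositionSubgroup (absoluteGaloisGroup ℚ), g • T = T) →
          T = 0) :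
    u ∈ selmerLocalKer W (v.adicCompletion ℚ) n := by
  obtain ⟨w, hw⟩ := exists_liesOver K v
  have hx : resTorsion W K n u ∈ selmerLocalKer (W.baseChange K) (w.adicCompletion K) n := hu ▸ hK w
  by_cases hcv : ((c : ℤ) : 𝓞 ℚ) ∈ v.asIdeal
  · obtain ⟨𝔔, h𝔔⟩ := w.primesAbove_nonempty
    exact mem_selmerLocalKer_of_resTorsion_mem_quadratic_of_fixed_two_torsion_eq_zero W h2 hθ hc n v w hgood
      hn h𝔔 (hdef hcv w 𝔔 h𝔔) hx
  · exact mem_selmerLocalKer_of_resTorsion_mem_quadratic W h2 hθ hc n v w hgood hn h2v hcv hx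

omit [W.IsElliptic] in
/-- **Member `E^{(c')}`, one odd good place `v ∤ c n`** (`v` unramified in `K`; `E` and the twist good at `v`): the
ℚ-level Selmer condition of `y` at `v` from the `K`-level condition of `c_K = hPsiKT (res y)` at the places above
`v` (`hPsiKT` respects the Selmer condition, `…TwistLocalConditions`; then `…SelmerDescentQuadratic` for the twist
equation). [cite: McCallumLMS1991, §4 Lemma 4.3] [cite: SilvermanAEC2009, X.5 Cor. 5.4] -/
theorem mem_selmerLocalKer_twin_of_K (h2 : Module.finrank ℚ K = 2) {θ₀ : K}
    (hθ₀ : θ₀ ∉ (algebraMap ℚ K).range) {c : ℤ} (hc₀ : θ₀ ^ 2 = algebraMap ℚ K c)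
    {θ : K} {c' : ℚ} (hθ : θ ∉ Set.range (algebraMap ℚ K)) (hc : θ ^ 2 = algebraMap ℚ K c')
    [(W.quadraticTwist c').IsElliptic] (n : ℤ) {y : galH1Torsion (W.quadraticTwist c') n}
    {cK : galH1Torsion (W.baseChange K) n}
    (hy : hPsiKT W K hθ hc n (resTorsion (W.quadraticTwist c') K n y) = cK) (v : HeightOneSpectrum (𝓞 ℚ))
    (hgood' : (W.quadraticTwist c').HasGoodReductionAt v) (hn : (n : 𝓞 ℚ) ∉ v.asIdeal)
    (h2v : (2 : 𝓞 ℚ) ∉ v.asIdeal) (hcv : ((c : ℤ) : 𝓞 ℚ) ∉ v.asIdeal)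
    (hK : ∀ (w : HeightOneSpectrum (𝓞 K)) [w.asIdeal.LiesOver v.asIdeal],
      cK ∈ selmerLocalKer (W.baseChange K) (w.adicCompletion K) n) :
    y ∈ selmerLocalKer (W.quadraticTwist c') (v.adicCompletion ℚ) n := by
  obtain ⟨w, hw⟩ := exists_liesOver K v
  have hx : resTorsion (W.quadraticTwist c') K n y ∈
      selmerLocalKer ((W.quadraticTwist c').baseChange K) (w.adicCompletion K) n := by
    rw [mem_selmerLocalKer_iff_hPsiKT_mem W K hθ hc n (w.adicCompletion K), hy]
    exact hK w
  exact mem_selmerLocalKer_of_resTorsion_mem_quadratic (W.quadraticTwist c') h2 hθ₀ hc₀ n v w hgood' hn h2v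
    hcv hx

/-! ## §2 The `Input` fields -/

section Fields

variable [W.IsGloballyMinimal] {M : ℕ} {θ : K} (hθ : θ ∉ Set.range (algebraMap ℚ K))
  (hθsq : θ ^ 2 = algebraMap ℚ K ((NumberField.discr K : ℤ) : ℚ))

include hθ hθsq in
/-- **`Input.loc_c₁_fin` from Lemma 4.3 over `K`** for the classes `c_K(m)` at the places `w ∤ m` of `K`, the
descent identities `res (c₁ m) = c_K(m)`, the DEF-free hypothesis at the primes of `d_K` where it is needed, and the
RESIDUAL ℚ-hypothesis at the places `v ∋ 2` or bad for `E`. [cite: McCallumLMS1991, §4 Lemma 4.3]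
[cite: Kolyvagin1989Izv, §3] -/
theorem loc_c₁_fin_of_K (h2 : Module.finrank ℚ K = 2) (c₁ : ℕ → galH1Torsion W (lvl M))
    (cK : ℕ → galH1Torsion (W.baseChange K) (lvl M))
    (hres : ∀ m, KolSupp (kolPrime W K M) m → Even m.primeFactors.card →
      resTorsion W K (lvl M) (c₁ m) = cK m)
    (hK43 : ∀ m, KolSupp (kolPrime W K M) m → ∀ w : HeightOneSpectrum (𝓞 K), (m : 𝓞 K) ∉ w.asIdeal →
      cK m ∈ selmerLocalKer (W.baseChange K) (w.adicCompletion K) (lvl M))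
    (hdef : ∀ v : HeightOneSpectrum (𝓞 ℚ), ((NumberField.discr K : ℤ) : 𝓞 ℚ) ∈ v.asIdeal →
      ∀ (w : HeightOneSpectrum (𝓞 K)) [w.asIdeal.LiesOver v.asIdeal], ∀ 𝔔 ∈ w.primesAbove,
        ∀ T : geomTorsion W (lvl M), 2 • T = 0 →
          (∀ g ∈ (𝔔.comap (absIntegersMap ℚ K)).decompositionSubgroup (absoluteGaloisGroup ℚ), g • T = T) →
            T = 0)
    (hres2N : ∀ m, KolSupp (kolPrime W K M) m → Even m.primeFactors.card → ∀ v : HeightOneSpectrum (𝓞 ℚ),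
      (m : 𝓞 ℚ) ∉ v.asIdeal → ((2 : 𝓞 ℚ) ∈ v.asIdeal ∨ ¬ W.HasGoodReductionAt v) →
        c₁ m ∈ selmerLocalKer W (v.adicCompletion ℚ) (lvl M)) :
    ∀ m, KolSupp (kolPrime W K M) m → Even m.primeFactors.card → ∀ v : HeightOneSpectrum (𝓞 ℚ),
      (m : 𝓞 ℚ) ∉ v.asIdeal → c₁ m ∈ selmerLocalKer W (v.adicCompletion ℚ) (lvl M) := by
  intro m hm hev v hmv
  by_cases hbad : (2 : 𝓞 ℚ) ∈ v.asIdeal ∨ ¬ W.HasGoodReductionAt v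
  · exact hres2N m hm hev v hmv hbad
  push Not at hbad
  obtain ⟨h2v, hgood⟩ := hbad
  have hn : (((2 ^ M : ℕ) : ℤ) : 𝓞 ℚ) ∉ v.asIdeal := by
    rw [Int.cast_natCast, Nat.cast_pow, Nat.cast_ofNat]
    exact fun h ↦ h2v (v.isPrime.mem_of_pow_mem M h)
  exact mem_selmerLocalKer_of_K W h2 (not_mem_range hθ) hθsq (lvl M) (hres m hm hev) v hgood hn h2v
    (fun w _ ↦ hK43 m hm w (intCast_notMem_of_liesOver K v w (n := (m : ℤ)) (by exact_mod_cast hmv) |>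
      fun h ↦ by exact_mod_cast h))
    (hdef v)

include hθ hθsq in
omit [W.IsElliptic] in
/-- **`Input.loc_c₂_fin` from Lemma 4.3 over `K`** for `c_K(m)`, the descent identities
`hPsiKT (res (c₂ m)) = c_K(m)`, and the RESIDUAL ℚ-hypothesis at the places `v ∋ 2`, bad for `E^{(d_K)}`, or
`v ∣ d_K` (where the twin is additive). [cite: McCallumLMS1991, §4 Lemma 4.3] [cite: Kolyvagin1989Izv, §3] -/
theorem loc_c₂_fin_of_K (h2 : Module.finrank ℚ K = 2) [(twin W K).IsElliptic]
    (c₂ : ℕ → galH1Torsion (twin W K) (lvl M)) (cK : ℕ → galH1Torsion (W.baseChange K) (lvl M))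
    (hres : ∀ m, KolSupp (kolPrime W K M) m → Odd m.primeFactors.card →
      hPsiKT W K hθ hθsq (lvl M) (resTorsion (twin W K) K (lvl M) (c₂ m)) = cK m)
    (hK43 : ∀ m, KolSupp (kolPrime W K M) m → ∀ w : HeightOneSpectrum (𝓞 K), (m : 𝓞 K) ∉ w.asIdeal →
      cK m ∈ selmerLocalKer (W.baseChange K) (w.adicCompletion K) (lvl M))
    (hres2Nd : ∀ m, KolSupp (kolPrime W K M) m → Odd m.primeFactors.card → ∀ v : HeightOneSpectrum (𝓞 ℚ),
      (m : 𝓞 ℚ) ∉ v.asIdeal →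
        ((2 : 𝓞 ℚ) ∈ v.asIdeal ∨ ¬ (twin W K).HasGoodReductionAt v ∨
          ((NumberField.discr K : ℤ) : 𝓞 ℚ) ∈ v.asIdeal) →
        c₂ m ∈ selmerLocalKer (twin W K) (v.adicCompletion ℚ) (lvl M)) :
    ∀ m, KolSupp (kolPrime W K M) m → Odd m.primeFactors.card → ∀ v : HeightOneSpectrum (𝓞 ℚ),
      (m : 𝓞 ℚ) ∉ v.asIdeal → c₂ m ∈ selmerLocalKer (twin W K) (v.adicCompletion ℚ) (lvl M) := by
  intro m hm hodd v hmv
  by_cases hbad : (2 : 𝓞 ℚ) ∈ v.asIdeal ∨ ¬ (twin W K).HasGoodReductionAt v ∨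
      ((NumberField.discr K : ℤ) : 𝓞 ℚ) ∈ v.asIdeal
  · exact hres2Nd m hm hodd v hmv hbad
  push Not at hbad
  obtain ⟨h2v, hgood', hdv⟩ := hbad
  have hn : (((2 ^ M : ℕ) : ℤ) : 𝓞 ℚ) ∉ v.asIdeal := by
    rw [Int.cast_natCast, Nat.cast_pow, Nat.cast_ofNat]
    exact fun h ↦ h2v (v.isPrime.mem_of_pow_mem M h)
  exact mem_selmerLocalKer_twin_of_K W h2 (not_mem_range hθ) hθsq hθ hθsq (lvl M) (hres m hm hodd) v hgood' hn
    h2v hdv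
    (fun w _ ↦ hK43 m hm w (intCast_notMem_of_liesOver K v w (n := (m : ℤ)) (by exact_mod_cast hmv) |>
      fun h ↦ by exact_mod_cast h))

omit [W.IsGloballyMinimal] in
/-- **`Input.loc_c₁_inf` is free on the habitat `Δ(E) < 0`** (`…ArchimedeanSelmerLevel`). [cite: MilneADT2006, I Rem. 3.7] -/
theorem loc_c₁_inf_of_Δ_neg (hΔ : W.Δ < 0) (P : ℕ → Prop) (Q : ℕ → Prop) (c₁ : ℕ → galH1Torsion W (lvl M)) :
    ∀ m, P m → Q m → ∀ w : InfinitePlace ℚ, c₁ m ∈ selmerLocalKer W w.Completion (lvl M) :=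
  fun m _ _ w ↦ mem_selmerLocalKer_infinitePlace_of_Δ_neg W w hΔ (lvl M) (c₁ m)

omit [W.IsGloballyMinimal] in
/-- **`Input.loc_c₂_inf` is free on the habitat `Δ(E) < 0`** (the twin has `Δ(E^{(d_K)}) = d_K⁶ Δ(E) < 0`).
[cite: MilneADT2006, I Rem. 3.7] -/
theorem loc_c₂_inf_of_Δ_neg (hΔ : W.Δ < 0) (P : ℕ → Prop) (Q : ℕ → Prop)
    (c₂ : ℕ → galH1Torsion (twin W K) (lvl M)) :
    ∀ m, P m → Q m → ∀ w : InfinitePlace ℚ, c₂ m ∈ selmerLocalKer (twin W K) w.Completion (lvl M) :=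
  fun m _ _ w ↦ mem_selmerLocalKer_infinitePlace_quadraticTwist_of_Δ_neg W w hΔ
    (by exact_mod_cast NumberField.discr_ne_zero K) (lvl M) (c₂ m)


end Fields

end Summit.BirchSwinnertonDyer.BirchSwinnertonDyer.Theorems.GenusExact.VisiblePairAtTwo

end
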